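import Mathlib
import Summits.Ventures.HodgeRepro2.T5Persistence

/-!
# T6N42Tower — the Witt-tower skeleton of TIER5 §B rows B3–B4 (sub-step N4.2), carrier-free

Pre-M2 glue over seat p3's ACCEPTED model `T5Persistence.TowerOccurrence` (p390600: a tower occurrence
is `n : ℕ`, `occurs : ℕ → Prop` («π is a quotient of ω_{m,m′}», indexed by the dimension of the tower
member), `stable : occurs n`; `first` = the first occurrence `m₀`). TIER5 §B rows B3–B4 (route-3,
record) argue: «Θ_χ(β′_v, 0-space) ≠ 0 ⟺ β′_v = 1 … for β′_v ≠ 1 the first occurrence in this tower is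
m₀ = 2 = W_{12,v} ⟹ θ(β′_v) = π_{0,v} supercuspidal [HKS96 Prop. 5.1(ii)]» and «m₀ ≤ 1 because
Θ_χ(π_{0,v}, V′_v) ≠ 0: Hom(ω, β′_v ⊗ π_{0,v}) ≠ 0 is symmetric in the two members ⟹ (iii) with m = 3 ≥ m₀
⟹ Θ_χ(π_{0,v}, V_v) ≠ 0 [HKS96 Prop. 5.1(iii), persistence]». This file carries exactly that
logic: the printed inputs — HKS96 Prop. 5.1(ii) («first ocurrence»), 5.1(iii) («persistence»), the
tower's parity and the zero-dimensional step — enter as HYPOTHESES in the shape the M2 displays will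
have (Props of the M2 local datum, TARGET-T6 §4 L4), and the conclusion is the occurrence at
dimension 3 (= `V_v = V′_v ⊕ ℍ`, TIER5 §B row B4). No printed statement is asserted here; nothing is
displayed; the file is the M2 glue prepared in advance (route/T6-N42-t6-p5.md §6).
-/

namespace Summit.Ventures.HodgeRepro2.T6.N42Tower

open Summit.Ventures.HodgeRepro2 T5Persistence

/-- HKS96 Prop. 5.1(iii) («persistence: if m ≥ m₀, then Θ_χ(π, V_m^ϵ) ≠ 0») in the shape of seat p3's
model: every tower member of dimension at least the first occurrence is an occurrence. -/
def Persists (T : TowerOccurrence) : Prop := ∀ m', T.first ≤ m' → T.occurs m'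

/-- Persistence is upward closure of `occurs` (seat p3's `persists_iff_upwardClosed`, unfolded). -/
theorem occurs_of_occurs_of_le {T : TowerOccurrence} (hP : Persists T) {a b : ℕ} (ha : T.occurs a)
    (hab : a ≤ b) : T.occurs b :=
  (T.persists_iff_upwardClosed.mp hP) a b ha hab

/-- TIER5 §B row B4: if `π` occurs at dimension 1 of its tower (the one-dimensional member `V′_v`,
by the symmetry of `Hom(ω, β′ ⊗ π) ≠ 0`) and persists, it occurs at dimension 3 (`V_v = V′_v ⊕ ℍ`). -/
theorem occurs_three_of_occurs_one {T : TowerOccurrence} (hP : Persists T) (h1 : T.occurs 1) :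
    T.occurs 3 :=
  T.occurs_add_of_occurs hP h1 2

/-- In a tower whose members all have even dimension (the `W`-tower of TIER5 §B row B3: the
0-space and the 2-dimensional class of `W_{12,v}`), an occurrence at dimension 2 which is not
an occurrence at dimension 0 has first occurrence exactly 2. -/
theorem first_eq_two {T : TowerOccurrence} (hodd : ∀ m, Odd m → ¬ T.occurs m)
    (h0 : ¬ T.occurs 0) (h2 : T.occurs 2) : T.first = 2 := by
  have hle : T.first ≤ 2 := T.first_le_of_occurs h2
  rcases Nat.lt_or_ge T.first 2 with hlt | hge
  · exfalso
    have hocc := T.occurs_first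
    interval_cases h : T.first
    · exact h0 hocc
    · exact hodd 1 ⟨0, rfl⟩ hocc
  · exact le_antisymm hle hge

/-- The skeleton of TIER5 §B rows B3–B4 for one finite place, with the printed inputs as hypotheses
in the shape of the M2 displays. `TW` is the occurrence datum of the character `β′_v` in the even
`W`-tower (`TW.occurs 0 ↔ β′_v = 1` is seat p3's `hasPartner_trivial_iff` — here the consequence
`¬ TW.occurs 0` is the hypothesis `hβ`), `TV` the occurrence datum of `π_{0,v} = θ(β′_v)` in the
`V`-tower on `V′_v`; `sc : Prop` stands for «π_{0,v} is supercuspidal».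
* `hHKSii` : HKS96 Prop. 5.1(ii) — first occurrence at `2` makes the lift supercuspidal;
* `hHKSiii` : HKS96 Prop. 5.1(iii) — a supercuspidal `π_{0,v}` persists in its tower;
* `hsym` : `π_{0,v}` occurs at the one-dimensional member (symmetry of the pairing);
and the conclusion is the occurrence at dimension `3`, i.e. `Θ_χ(π_{0,v}, V_v) ≠ 0` (row B4). -/
theorem occurs_three_of_rows_B3_B4 {TW TV : TowerOccurrence} {sc : Prop}
    (hodd : ∀ m, Odd m → ¬ TW.occurs m) (hβ : ¬ TW.occurs 0) (hW2 : TW.occurs 2)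
    (hHKSii : TW.first = 2 → sc) (hHKSiii : sc → Persists TV) (hsym : TV.occurs 1) :
    TV.occurs 3 :=
  occurs_three_of_occurs_one (hHKSiii (hHKSii (first_eq_two hodd hβ hW2))) hsym

end Summit.Ventures.HodgeRepro2.T6.N42Tower
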